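import Mathlib
import HarnessLib
import Summits.NavierStokesRegularity.NavierStokesRegularity.Theorems.StretchingWellBindingEnstrophyQuarterLawLambBudgetVorticityAssembly

/-!
# Shelf 1574 on the Type-I stratum: the four typed currencies of the quarter law coincide, PER SOLUTION

Helper file (`--supports stmt-NavierStokesRegularity-1574 --as helper`). For ONE maximal classical Leray–Hopf solution
`u` on `[0,T)` from a rapidly decaying datum which blows up at the sup-rate Type-I rate (`IsTypeIBlowup u T` — the
conclusion of the shared hard core 0056 for this solution), the following are EQUIVALENT (`List.TFAE`), with no
further hypothesis:

1. the SLICE quarter law `∃ K, ∫ |curl u(t)|² ≤ K/√(T−t)` on `[0,T)` (crux `EnstrophyQuarterLaw`, 1574, for `u`);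
2. the WINDOW quarter law `∃ K, ∫_a^b ∫ |curl u|² ≤ K√(b−a)` (crux `EnergyHalfHolder`, 25161, for `u`);
3. volume sparseness of the velocity FAST SET `{|u(s)| > c₀√(ν/(T−s))}` (LINE 7's `B`, any `c₀ ∈ (0,1)`);
4. volume sparseness of the HIGH-VORTICITY SET `{|curl u(s)| > c₂/(T−s)}` (LINE 7 twin's `B_ω`, any
   `c₂ ∈ (0,1/4)`).

All four edges are tree theorems used by name: 1 → 2 `WindowConverters.lintegral_Ioo_le_sqrt_of_slice_le` (ns-hhe-c1
g0, p606985), 2 → 1 `EnstrophyQuarterLaw.stub_windowToSlice` (g0, p608800), 1 ↔ 3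
`LambBudget.sliceLaw_iff_typeI_and_volumeSparse` (g3, p625040), 1 ↔ 4 `LambBudget.sliceLaw_iff_typeI_and_vorticitySparse`
(g5, p636294). This is the kernel form, per solution, of ns-idea-9's LINE 8 census («modulo 0056 every faithful slice
reformulation of EQL is equivalent»): on the Type-I stratum the open content of 1574 is ONE statement in four clothes.

HONEST FRAMING: an equivalence of four OPEN per-solution properties on a hypothetical Type-I blow-up; nothing about
Navier–Stokes regularity is asserted; `EnstrophyQuarterLaw` 1574, `EnergyHalfHolder` 25161, 0056, `B`, `B_ω` stay OPEN.
No summit statement is proved.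
-/

noncomputable section

-- the summit-side namespace repeats a component by design (D-0017)
set_option linter.dupNamespace false

namespace Summit.NavierStokesRegularity.NavierStokesRegularity.Theorems.EnstrophyQuarterLaw.LambBudget

open Set MeasureTheory Function Metric Filter Topology
open scoped ENNReal NNReal
open Literature.Analysis.FluidPDE
open Summit.NavierStokesRegularity.NavierStokesRegularity

/-- **On the Type-I stratum, slice law ⟺ window law, per solution** (`⇒` one integration, `⇐` Serrin `(2,∞)`
enstrophy inequality over `[2t−T, t]` = `stub_windowToSlice`). [folklore] -/
theorem sliceLaw_iff_windowLaw_of_typeI {ν T : ℝ} (hν : 0 < ν) (hT : 0 < T)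
    {u : ℝ → EuclideanSpace ℝ (Fin 3) → EuclideanSpace ℝ (Fin 3)} {p : ℝ → EuclideanSpace ℝ (Fin 3) → ℝ}
    (hmax : IsMaximalSmoothSolution ν 0 u p T) (hLH : IsLerayHopfOn T ν 0 (u 0) u)
    (hdec : HasRapidSpatialDecay (u 0)) (hTI : IsTypeIBlowup u T) :
    (∃ K : ℝ, ∀ t ∈ Set.Ico 0 T, ∫⁻ x, ‖curl (u t) x‖ₑ ^ 2 ≤ ENNReal.ofReal (K / Real.sqrt (T - t))) ↔
      (∃ K : ℝ, ∀ a b : ℝ, 0 ≤ a → a ≤ b → b ≤ T →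
        ∫⁻ t in Set.Ioo a b, ∫⁻ x, ‖curl (u t) x‖ₑ ^ 2 ≤ ENNReal.ofReal (K * Real.sqrt (b - a))) := by
  constructor
  · rintro ⟨K, hK⟩
    refine ⟨2 * max K 0, fun a b ha hab hb => ?_⟩
    have hK' : ∀ t ∈ Ico 0 T,
        ∫⁻ x, ‖curl (u t) x‖ₑ ^ 2 ≤ ENNReal.ofReal (max K 0 / Real.sqrt (T - t)) :=
      fun t ht => (hK t ht).trans
        (ENNReal.ofReal_le_ofReal (div_le_div_of_nonneg_right (le_max_left _ _) (Real.sqrt_nonneg _)))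
    exact Theorems.WindowConverters.lintegral_Ioo_le_sqrt_of_slice_le (le_max_right K 0) hK' ha hab hb
  · intro hW
    exact Theorems.EnstrophyQuarterLaw.stub_windowToSlice ν T hν hT u p hmax hLH hdec hTI hW

/-- **The four currencies of the quarter law coincide on the Type-I stratum, per solution** (`List.TFAE` of:
slice law · window law · fast-set volume sparseness at `c₀` · high-vorticity volume sparseness at `c₂`), for every
`c₀ ∈ (0,1)`, `c₂ ∈ (0,1/4)` and every maximal classical Leray–Hopf solution from a rapidly decaying datum with
`IsTypeIBlowup u T`. [folklore] -/
theorem typeIStratum_currencies_tfae {c₀ c₂ : ℝ} (hc₀ : 0 < c₀) (hc₁ : c₀ < 1) (hc₂ : 0 < c₂)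
    (hc₂' : c₂ < 1 / 4) {ν T : ℝ} (hν : 0 < ν) (hT : 0 < T)
    {u : ℝ → EuclideanSpace ℝ (Fin 3) → EuclideanSpace ℝ (Fin 3)} {p : ℝ → EuclideanSpace ℝ (Fin 3) → ℝ}
    (hmax : IsMaximalSmoothSolution ν 0 u p T) (hLH : IsLerayHopfOn T ν 0 (u 0) u)
    (hdec : HasRapidSpatialDecay (u 0)) (hTI : IsTypeIBlowup u T) :
    List.TFAE
      [∃ K : ℝ, ∀ t ∈ Set.Ico 0 T, ∫⁻ x, ‖curl (u t) x‖ₑ ^ 2 ≤ ENNReal.ofReal (K / Real.sqrt (T - t)),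
       ∃ K : ℝ, ∀ a b : ℝ, 0 ≤ a → a ≤ b → b ≤ T →
         ∫⁻ t in Set.Ioo a b, ∫⁻ x, ‖curl (u t) x‖ₑ ^ 2 ≤ ENNReal.ofReal (K * Real.sqrt (b - a)),
       ∃ N : ℝ, ∀ s ∈ Set.Ico 0 T,
         volume {x : EuclideanSpace ℝ (Fin 3) | c₀ * Real.sqrt (ν / (T - s)) < ‖u s x‖} ≤
           ENNReal.ofReal (N * Real.sqrt (ν * (T - s)) ^ 3),
       ∃ N : ℝ, ∀ s ∈ Set.Ico 0 T,
         volume {x : EuclideanSpace ℝ (Fin 3) | c₂ / (T - s) < ‖curl (u s) x‖} ≤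
           ENNReal.ofReal (N * Real.sqrt (ν * (T - s)) ^ 3)] := by
  have h12 := sliceLaw_iff_windowLaw_of_typeI hν hT hmax hLH hdec hTI
  have h13 := sliceLaw_iff_typeI_and_volumeSparse hc₀ hc₁ hν hT hmax hLH hdec
  have h14 := sliceLaw_iff_typeI_and_vorticitySparse hc₂ hc₂' hν hT hmax hLH hdec
  tfae_have 1 ↔ 2 := h12
  tfae_have 1 ↔ 3 := by
    rw [h13]
    exact ⟨fun h => h.2, fun h => ⟨hTI, h⟩⟩
  tfae_have 1 ↔ 4 := by
    rw [h14]
    exact ⟨fun h => h.2, fun h => ⟨hTI, h⟩⟩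
  tfae_finish

end Summit.NavierStokesRegularity.NavierStokesRegularity.Theorems.EnstrophyQuarterLaw.LambBudget

end
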